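import Literature.MathematicalPhysics.QuantumFieldTheory.Balaban1983to89.MatrixLog

/-!
# `Balaban1983to89.B11Eq172LogBound` — [Balaban1985Variational] Sect. G, (172) p. 305: «V′ satisfies |V′ − 1| < C₁ε₁,
# hence V′ = e^{iB′}, |B′| < 2C₁ε₁ on 𝔅_k, (172) for ε₁ sufficiently small» — PROVED from the tree's matrix logarithm

statement-level skeleton of published theorems with citation tags; proofs where landed; nothing here is a claim about the Yang–Mills mass gap

CITATION HEADER (lean-in-tree rule 2026-08-18).  T. Bałaban, *The variational problem and background fields in
renormalization group method for lattice gauge theories*, Commun. Math. Phys. **102**, 277–309 (1985),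
doi:10.1007/bf01229381 [Balaban1985Variational] (cell paper B11; held `paper:balaban1985-cmp102-variational-background`,
journal page = PDF page + 276); p. 305 [PDF 29] from the render-verified transcript
`run/shared/lean/pub/pub-balaban/b2b-balaban-b11/transcript.md` (render `…-p029-x2.png`).  The logarithm is the
tree's `MatrixLog.mlog` (= [4] (21), `Literature.Analysis.Complex.logOnePlus` at `X − 1`), used BY NAME with its bound
`MatrixLog.norm_mlog_le_two_mul` (`|log X| ≤ 2|X − 1|` for `|X − 1| ≤ ½`) and `MatrixLog.exp_mlog`.

THE PRINT (p. 305, verbatim).  *«Now let us take V = V′V₀, V₀ satisfies the condition (7), V′ satisfies |V′ − 1| < C₁ε₁,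
hence V′ = e^{iB′}, |B′| < 2C₁ε₁ on 𝔅_k, (172) for ε₁ sufficiently small.»*

WHAT IS PROVED.  For `V′` in a complete normed ℂ-algebra (a bond variable of the datum) with `‖V′ − 1‖ < C₁ε₁` and the
smallness `C₁ε₁ ≤ ½` (the printed *«for ε₁ sufficiently small»*): `B′ := (1/i) log V′` satisfies `exp (iB′) = V′` and
`‖B′‖ < 2C₁ε₁` (`eq172`).  Unit `lit-balaban-r08` (row B11.Eq172 / r08.82 of `HOME/lit-balaban-r08/ROWS-B11.md`).
-/

namespace Literature.MathematicalPhysics.QuantumFieldTheory.Balaban1983to89.B11Eq172LogBound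

open NormedSpace
open Literature.MathematicalPhysics.QuantumFieldTheory.Balaban1983to89.MatrixLog

variable {𝔄 : Type*} [NormedRing 𝔄] [NormedAlgebra ℂ 𝔄] [CompleteSpace 𝔄]

/-- **(172)** p. 305: *«V′ satisfies |V′ − 1| < C₁ε₁, hence V′ = e^{iB′}, |B′| < 2C₁ε₁ on 𝔅_k, (172) for ε₁ sufficiently
small»* — with `B′ = (1/i) log V′ = −i·log V′` (`MatrixLog.mlog`) and the smallness `C₁ε₁ ≤ ½`.
[cite: Balaban1985Variational, (172) p.305] -/
theorem eq172 {V' : 𝔄} {C₁ε₁ : ℝ} (hV : ‖V' - 1‖ < C₁ε₁) (hsmall : C₁ε₁ ≤ 1 / 2) :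
    exp (Complex.I • ((-Complex.I) • mlog V')) = V' ∧ ‖(-Complex.I) • mlog V'‖ < 2 * C₁ε₁ := by
  have h1 : ‖V' - 1‖ < 1 := by linarith
  have h2 : ‖V' - 1‖ ≤ 1 / 2 := by linarith
  constructor
  · rw [smul_smul]
    simp [exp_mlog h1]
  · rw [norm_smul, norm_neg, Complex.norm_I, one_mul]
    exact (norm_mlog_le_two_mul h2).trans_lt (by linarith)

end Literature.MathematicalPhysics.QuantumFieldTheory.Balaban1983to89.B11Eq172LogBound
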